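import Literature.Probability.RandomPlanarGeometry.RadialLoewnerDiscMaps
import HarnessLib

/-!
# Locality in time of the radial Loewner chain

Topic `Probability/RandomPlanarGeometry`; theorems only (no definition, no named fact). The radial
Loewner domain `D_u` and map `g_u` of a continuous driving function `U` depend on `U` only through
its restriction to `[0, u]` (Lawler (2005), §4.2: the chain up to time `u` is the flow of the ODE
on `[0, u]`):

* `RadialLoewner.Disc.domain_subset_domain_of_eqOn`, `domain_eq_of_eqOn` — if `U = U'` on `[0, u]`
  then `D_u(U) = D_u(U')` (a solution for `U` alive past `u` is a solution for `U'` with lifetime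
  `u` staying away from the driving point, hence extends: `coe_lt_swallowingTime_of_le_norm_sub`);
* `RadialLoewner.Disc.map_eq_map_of_eqOn` — and `g_u(U) = g_u(U')` on `D_u` (uniqueness
  `IsSolution.eqOn` on `[0, u)` and continuity at `u`);
* `RadialLoewner.Disc.invFunOn_map_eq_of_eqOn` — hence the inverse maps agree on `𝔻`.

## References

* G. F. Lawler, *Conformally Invariant Processes in the Plane*, AMS (2005), §4.2. [Lawler2005]
-/

noncomputable section

open Set Filter Topology Metric Complex
open scoped NNReal

namespace Literature.Probability.RandomPlanarGeometry

namespace RadialLoewner.Disc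

variable {U U' : ℝ≥0 → ℝ} {u : ℝ≥0}

/-- Driving points agree up to time `u` when the drivers do. [folklore] -/
theorem drivingPt_eq_of_eqOn (heq : ∀ s : ℝ≥0, s ≤ u → U s = U' s) {t : ℝ} (ht : t ≤ u) :
    drivingPt U t = drivingPt U' t := by
  rw [drivingPt_apply, drivingPt_apply, heq _ (Real.toNNReal_le_iff_le_coe.2 ht)]

/-- A solution for `U` alive past `u` is a solution for `U'` with lifetime `u`, when `U = U'` on
`[0, u]`. [folklore] -/
theorem IsSolution.of_eqOn_driver {z : ℂ} {g : ℝ → ℂ} {T : WithTop ℝ≥0} (h : IsSolution U z g T)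
    (hu : (u : WithTop ℝ≥0) ≤ T) (heq : ∀ s : ℝ≥0, s ≤ u → U s = U' s) :
    IsSolution U' z g u := by
  have hsub : timeDom (u : WithTop ℝ≥0) ⊆ timeDom T := fun t ht ↦ ⟨ht.1, lt_of_lt_of_le ht.2 hu⟩
  have hlt : ∀ {t : ℝ}, t ∈ timeDom (u : WithTop ℝ≥0) → t < u := fun ht ↦ by
    have := WithTop.coe_lt_coe.1 ht.2
    rw [← NNReal.coe_lt_coe, Real.coe_toNNReal _ ht.1] at this
    exact this
  refine ⟨h.1, fun t ht ↦ ?_, fun t ht0 htu ↦ ?_⟩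
  · have hd := (h.2.1 t (hsub ht)).mono hsub
    rwa [field_apply, drivingPt_eq_of_eqOn heq (hlt ht).le, ← field_apply] at hd
  · rw [← drivingPt_eq_of_eqOn heq (hlt ⟨ht0, htu⟩).le]
    exact h.2.2 t ht0 (lt_of_lt_of_le htu hu)

/-- **Locality of the radial domains** (one inclusion). [cite: Lawler2005, §4.2] -/
theorem domain_subset_domain_of_eqOn (hU : Continuous U) (hU' : Continuous U')
    (heq : ∀ s : ℝ≥0, s ≤ u → U s = U' s) : domain U u ⊆ domain U' u := by
  intro z hz
  obtain ⟨hzball, hzu⟩ := (mem_domain_iff U u z).1 hz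
  rcases eq_or_ne u 0 with rfl | hu0
  · rw [domain_zero hU']; exact hzball
  have hupos : 0 < u := pos_iff_ne_zero.2 hu0
  obtain ⟨g, hg⟩ := exists_isSolution_swallowingTime hU z
  have h' : IsSolution U' z g u := hg.of_eqOn_driver hzu.le heq
  have hb : ((u : ℝ).toNNReal : WithTop ℝ≥0) < swallowingTime U z := by rwa [Real.toNNReal_coe]
  obtain ⟨δ, hδ, hfar⟩ := hg.exists_le_norm_sub hU u.coe_nonneg hb
  have hfar' : ∀ t : ℝ, 0 ≤ t → t < u → (δ : ℝ) ≤ ‖drivingPt U' t - g t‖ := fun t ht0 htu ↦ by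
    rw [← drivingPt_eq_of_eqOn heq htu.le]; exact hfar t ⟨ht0, htu.le⟩
  exact (mem_domain_iff U' u z).2 ⟨hzball, h'.coe_lt_swallowingTime_of_le_norm_sub hU' hupos hδ hfar'⟩

/-- **Locality of the radial domains**: `D_u(U) = D_u(U')` if `U = U'` on `[0, u]`.
[cite: Lawler2005, §4.2] -/
theorem domain_eq_of_eqOn (hU : Continuous U) (hU' : Continuous U')
    (heq : ∀ s : ℝ≥0, s ≤ u → U s = U' s) : domain U u = domain U' u :=
  Subset.antisymm (domain_subset_domain_of_eqOn hU hU' heq)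
    (domain_subset_domain_of_eqOn hU' hU fun s hs ↦ (heq s hs).symm)

/-- **Locality of the radial maps**: `g_u(U) = g_u(U')` on `D_u` if `U = U'` on `[0, u]`.
[cite: Lawler2005, §4.2] -/
theorem map_eq_map_of_eqOn (hU : Continuous U) (hU' : Continuous U')
    (heq : ∀ s : ℝ≥0, s ≤ u → U s = U' s) {z : ℂ} (hz : z ∈ domain U u) :
    map U u z = map U' u z := by
  have hz' : z ∈ domain U' u := domain_subset_domain_of_eqOn hU hU' heq hz
  obtain ⟨-, hzu⟩ := (mem_domain_iff U u z).1 hz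
  obtain ⟨-, hzu'⟩ := (mem_domain_iff U' u z).1 hz'
  obtain ⟨g, hg⟩ := exists_isSolution_swallowingTime hU z
  obtain ⟨g', hg'⟩ := exists_isSolution_swallowingTime hU' z
  rw [map_eq_of_isSolution hU hg hzu, map_eq_of_isSolution hU' hg' hzu']
  rcases eq_or_ne u 0 with rfl | hu0
  · simp only [NNReal.coe_zero]; rw [hg.1, hg'.1]
  have hupos : (0 : ℝ) < u := by exact_mod_cast pos_iff_ne_zero.2 hu0
  -- `g` is a `U'`-solution with lifetime `u`; uniqueness on `[0, u)`
  have h' : IsSolution U' z g u := hg.of_eqOn_driver hzu.le heq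
  have heqOn := IsSolution.eqOn hU' h' hg'
  -- pass to the limit `t ↑ u`
  have hIoo : Ioo (0 : ℝ) u ⊆ timeDom (min (u : WithTop ℝ≥0) (swallowingTime U' z)) := by
    intro t ht
    refine ⟨ht.1.le, lt_min ?_ ?_⟩
    · exact WithTop.coe_lt_coe.2 (by rw [← NNReal.coe_lt_coe, Real.coe_toNNReal _ ht.1.le]; exact ht.2)
    · refine lt_of_lt_of_le ?_ hzu'.le
      exact WithTop.coe_lt_coe.2 (by rw [← NNReal.coe_lt_coe, Real.coe_toNNReal _ ht.1.le]; exact ht.2)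
  have hev : g =ᶠ[𝓝[<] (u : ℝ)] g' := by
    filter_upwards [Ioo_mem_nhdsLT hupos] with t ht using heqOn (hIoo ht)
  have humem : (u : ℝ) ∈ timeDom (swallowingTime U z) := ⟨u.coe_nonneg, by rwa [Real.toNNReal_coe]⟩
  have humem' : (u : ℝ) ∈ timeDom (swallowingTime U' z) := ⟨u.coe_nonneg, by rwa [Real.toNNReal_coe]⟩
  have hsubT : Ioo (0 : ℝ) u ⊆ timeDom (swallowingTime U z) := fun t ht ↦
    ⟨ht.1.le, lt_trans (WithTop.coe_lt_coe.2 (by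
      rw [← NNReal.coe_lt_coe, Real.coe_toNNReal _ ht.1.le]; exact ht.2)) hzu⟩
  have hsubT' : Ioo (0 : ℝ) u ⊆ timeDom (swallowingTime U' z) := fun t ht ↦
    ⟨ht.1.le, lt_trans (WithTop.coe_lt_coe.2 (by
      rw [← NNReal.coe_lt_coe, Real.coe_toNNReal _ ht.1.le]; exact ht.2)) hzu'⟩
  have h1 : Tendsto g (𝓝[<] (u : ℝ)) (𝓝 (g u)) := by
    have hc : ContinuousWithinAt g (Ioo (0 : ℝ) u) u := (hg.continuousOn.continuousWithinAt humem).mono hsubT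
    rwa [ContinuousWithinAt, nhdsWithin_Ioo_eq_nhdsLT hupos] at hc
  have h2 : Tendsto g' (𝓝[<] (u : ℝ)) (𝓝 (g' u)) := by
    have hc : ContinuousWithinAt g' (Ioo (0 : ℝ) u) u := (hg'.continuousOn.continuousWithinAt humem').mono hsubT'
    rwa [ContinuousWithinAt, nhdsWithin_Ioo_eq_nhdsLT hupos] at hc
  exact tendsto_nhds_unique (h1.congr' hev) h2

/-- **Locality of the inverse radial maps** on `𝔻`. [cite: Lawler2005, §4.2] -/
theorem invFunOn_map_eq_of_eqOn (hU : Continuous U) (hU' : Continuous U')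
    (heq : ∀ s : ℝ≥0, s ≤ u → U s = U' s) {y : ℂ} (hy : y ∈ ball (0 : ℂ) 1) :
    Function.invFunOn (map U u) (domain U u) y = Function.invFunOn (map U' u) (domain U' u) y := by
  have hex : ∃ a ∈ domain U u, map U u a = y := (bijOn_map hU u).surjOn hy
  have hex' : ∃ a ∈ domain U' u, map U' u a = y := (bijOn_map hU' u).surjOn hy
  have hx1 := Function.invFunOn_mem hex
  have hx2 := Function.invFunOn_eq hex
  have hx1' := Function.invFunOn_mem hex'
  have hx2' := Function.invFunOn_eq hex'
  refine (bijOn_map hU' u).injOn ?_ hx1' ?_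
  · rwa [← domain_eq_of_eqOn hU hU' heq]
  · rw [hx2', ← map_eq_map_of_eqOn hU hU' heq hx1, hx2]

end RadialLoewner.Disc

end Literature.Probability.RandomPlanarGeometry
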